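import Summits.NavierStokesRegularity.NavierStokesRegularity.Theorems.EfficiencyFloorEnstrophyBudget
import Summits.NavierStokesRegularity.NavierStokesRegularity.Theorems.EfficiencyFloorProductionEfficiencyDecayIntegrateEfficiency
import Summits.NavierStokesRegularity.NavierStokesRegularity.Theses.EfficiencyFloor
import Literature.Analysis.FluidPDE.SelfSimilar
import HarnessLib

/-!
# Crux skeleton — `EfficiencyFloor.ProductionEfficiencyDecay` (stmt-NavierStokesRegularity-22866),
# line `efficiency-floor` (planner BC3 skeleton v3, lead prover-ns-ef-p1)

Composition: `stub_enstrophyBudget` (LANDED: `Theorems/EfficiencyFloorEnstrophyBudget.lean`,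
`EnstrophyBudget.main`, p579691) + `stub_depletionGivenBudget` (the crux proper: pointwise decay of the
Lu–Doering efficiency `Ż/Z³` at blow-up — OPEN-PROBLEM grade, equivalent to "no blow-up with positive
`limsup Ż/Z³`") + `stub_integrateEfficiency` (real analysis; landed as
`Theorems/EfficiencyFloorProductionEfficiencyDecayIntegrateEfficiency.lean`, p580238) ⟹
`ProductionEfficiencyDecay_of` (sorry-free composition).

Registered structural / plan-only stubs NOT used by the composition: `stub_dssStratumRung` (BC5: the crux on
the exactly-DSS stratum — by the log-periodicity computation in the lead's NOTES it is EQUIVALENT to the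
non-existence of an exactly discretely self-similar maximal Leray–Hopf blow-up from rapidly decaying data,
a DSS-Liouville statement, open) and `stub_efficiencyConcentration` (= support item stmt-23111: ε-efficient
stretching forces a δ(ε)-fraction of the enstrophy into one ball of radius K(ε)(Z/Pal)^{1/2}; provable).

No summit and no crux is proved by this file; NS regularity is not proved by anything here.
-/

-- the problem directory repeats the summit name (`NavierStokesRegularity/NavierStokesRegularity`)
set_option linter.dupNamespace false

noncomputable section

open Set Filter MeasureTheory Topology
open scoped InnerProductSpace ENNReal NNReal
open Literature.Analysis.FluidPDE

namespace Summit.NavierStokesRegularity.NavierStokesRegularity.Cruxes.ProductionEfficiencyDecay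

/-- S1 (LANDED, p579691): the enstrophy budget `dZ/dt = 2S − 2ν·Pal`, `|S| ≤ c Z^{3/4} Pal^{3/4}`. -/
theorem stub_enstrophyBudget : ∃ c : ℝ, 0 < c ∧ ∀ (ν T : ℝ), 0 < ν → 0 < T → ∀ (u : ℝ → EuclideanSpace ℝ (Fin 3) → EuclideanSpace ℝ (Fin 3)) (p : ℝ → EuclideanSpace ℝ (Fin 3) → ℝ), Literature.Analysis.FluidPDE.IsMaximalSmoothSolution ν 0 u p T → Literature.Analysis.FluidPDE.IsLerayHopfOn T ν 0 (u 0) u → Literature.Analysis.FluidPDE.HasRapidSpatialDecay (u 0) → ∃ (Zr Pr Sr : ℝ → ℝ), (∀ t ∈ Set.Ioo 0 T, ∫⁻ x, ‖Literature.Analysis.FluidPDE.curl (u t) x‖ₑ ^ 2 = ENNReal.ofReal (Zr t) ∧ 0 ≤ Zr t ∧ 0 ≤ Pr t ∧ Pr t = ∫ x, Literature.Analysis.FluidPDE.frobeniusNormSq (fderiv ℝ (Literature.Analysis.FluidPDE.curl (u t)) x) ∧ Sr t = ∫ x, ⟪Literature.Analysis.FluidPDE.curl (u t) x, fderiv ℝ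 (u t) x (Literature.Analysis.FluidPDE.curl (u t) x)⟫_ℝ ∧ HasDerivAt Zr (2 * Sr t - 2 * ν * Pr t) t ∧ |Sr t| ≤ c * Zr t ^ (3/4 : ℝ) * Pr t ^ (3/4 : ℝ)) :=
  Summit.NavierStokesRegularity.NavierStokesRegularity.Theorems.EnstrophyBudget.main

/-- S2 (THE CRUX PROPER, open-problem grade): given the budget, the production efficiency decays pointwise
at blow-up: for every `ε > 0`, eventually `Ż ≤ ε Z³` (and `Z > 0`). -/
theorem stub_depletionGivenBudget : ∀ (c ν T : ℝ), 0 < c → 0 < ν → 0 < T → ∀ (u : ℝ → EuclideanSpace ℝ (Fin 3) → EuclideanSpace ℝ (Fin 3)) (p : ℝ → EuclideanSpace ℝ (Fin 3) → ℝ), Literature.Analysis.FluidPDE.IsMaximalSmoothSolution ν 0 u p T → Literature.Analysis.FluidPDE.IsLerayHopfOn T ν 0 (u 0) u → Literature.Analysis.FluidPDE.HasRapidSpatialDecay (u 0) → ∀ (Zr Pr Sr : ℝ → ℝ), (∀ t ∈ Set.Ioo 0 T, ∫⁻ x, ‖Literature.Analysis.FluidPDE.curl (u t) x‖ₑ ^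 2 = ENNReal.ofReal (Zr t) ∧ 0 ≤ Zr t ∧ 0 ≤ Pr t ∧ Pr t = ∫ x, Literature.Analysis.FluidPDE.frobeniusNormSq (fderiv ℝ (Literature.Analysis.FluidPDE.curl (u t)) x) ∧ Sr t = ∫ x, ⟪Literature.Analysis.FluidPDE.curl (u t) x, fderiv ℝ (u t) x (Literature.Analysis.FluidPDE.curl (u t) x)⟫_ℝ ∧ HasDerivAt Zr (2 * Sr t - 2 * ν * Pr t) t ∧ |Sr t| ≤ c * Zr t ^ (3/4 : ℝ) * Pr t ^ (3/4 : ℝ)) → ∀ ε : ℝ, 0 < ε → ∃ t₁ ∈ Set.Ioo 0 T, ∀ t ∈ Set.Ico t₁ T, 0 < Zr t ∧ 2 * Sr t - 2 * ν * Pr t ≤ ε * Zr t ^ 3 := by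
  sorry

/-- S3 (real analysis; landed p580238): integrating `Ż ≤ ε Z³` to `Z(s)⁻² − Z(t)⁻² ≤ 2ε(t−s)`. -/
theorem stub_integrateEfficiency : ∀ (Zr : ℝ → ℝ) (t₁ T ε : ℝ), (∀ t ∈ Set.Ico t₁ T, 0 < Zr t) → (∀ t ∈ Set.Ico t₁ T, ∃ D : ℝ, HasDerivAt Zr D t ∧ D ≤ ε * Zr t ^ 3) → ∀ s t : ℝ, t₁ ≤ s → s ≤ t → t < T → (Zr s)⁻¹ ^ 2 - (Zr t)⁻¹ ^ 2 ≤ 2 * ε * (t - s) :=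
  Summit.NavierStokesRegularity.NavierStokesRegularity.Theorems.ProductionEfficiencyDecay.stub_integrateEfficiency

/-- S4 (BC5 plan-only rung, NOT used by the composition): the crux on the exactly-DSS stratum. -/
theorem stub_dssStratumRung : ∀ (ν T : ℝ), 0 < ν → 0 < T → ∀ (u : ℝ → EuclideanSpace ℝ (Fin 3) → EuclideanSpace ℝ (Fin 3)) (p : ℝ → EuclideanSpace ℝ (Fin 3) → ℝ), Literature.Analysis.FluidPDE.IsMaximalSmoothSolution ν 0 u p T → Literature.Analysis.FluidPDE.IsLerayHopfOn T ν 0 (u 0) u → Literature.Analysis.FluidPDE.HasRapidSpatialDecay (u 0) → (∃ c : ℝ, 1 < c ∧ Literature.Analysis.FluidPDE.IsDiscretelySelfSimilar c (fun s x => u (T + s) x)) → ∀ ε : ℝ, 0 < ε → ∃ t₁ ∈ Set.Ico 0 T, (∀ t ∈ Set.Ico t₁ T, 0 < ∫⁻ x, ‖Literature.Analysis.FluidPDE.curl (u t) x‖ₑ ^ 2 ∧ ∫⁻ x, ‖Literature.Analysis.FluidPDE.curl (u t) x‖ₑ ^ 2 < ⊤) ∧ ∀ s t : ℝ, t₁ ≤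 s → s ≤ t → t < T → ((∫⁻ x, ‖Literature.Analysis.FluidPDE.curl (u s) x‖ₑ ^ 2).toReal)⁻¹ ^ 2 - ((∫⁻ x, ‖Literature.Analysis.FluidPDE.curl (u t) x‖ₑ ^ 2).toReal)⁻¹ ^ 2 ≤ ε * (t - s) := by
  sorry

/-- S5 (structural lemma = support item stmt-23111, NOT used by the composition): ε-efficient stretching
forces enstrophy concentration in one ball at the scale `(Z/Pal)^{1/2}`. -/
theorem stub_efficiencyConcentration : ∀ ε : ℝ, 0 < ε → ∃ K δ : ℝ, 0 < K ∧ 0 < δ ∧ ∀ v : EuclideanSpace ℝ (Fin 3) → EuclideanSpace ℝ (Fin 3), ContDiff ℝ (⊤ : ℕ∞) v → Literature.Analysis.FluidPDE.VectorCalculus.IsDivFree v → (∫⁻ x, ‖iteratedFDeriv ℝ 0 v x‖ₑ ^ 2 < ⊤) → (∫⁻ x, ‖iteratedFDeriv ℝ 1 v x‖ₑ ^ 2 < ⊤) → (∫⁻ x, ‖iteratedFDeriv ℝ 2 v x‖ₑ ^ 2 < ⊤) → 0 < ∫ x, ‖Literature.Analysis.FluidPDE.curl v x‖ ^ 2 →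 0 < ∫ x, Literature.Analysis.FluidPDE.frobeniusNormSq (fderiv ℝ (Literature.Analysis.FluidPDE.curl v) x) → ε * (∫ x, ‖Literature.Analysis.FluidPDE.curl v x‖ ^ 2) ^ (3 / 4 : ℝ) * (∫ x, Literature.Analysis.FluidPDE.frobeniusNormSq (fderiv ℝ (Literature.Analysis.FluidPDE.curl v) x)) ^ (3 / 4 : ℝ) ≤ ∫ x, ⟪Literature.Analysis.FluidPDE.curl v x, fderiv ℝ v x (Literature.Analysis.FluidPDE.curl v x)⟫_ℝ → ∃ a : EuclideanSpace ℝ (Fin 3), δ * ∫ x, ‖Literature.Analysis.FluidPDE.curl v x‖ ^ 2 ≤ ∫ x in Metric.ball a (K * Real.sqrt ((∫ x, ‖Literature.Analysis.FluidPDE.curl v x‖ ^ 2) / ∫ x, Literature.Analysis.FluidPDE.frobeniusNormSq (fderiv ℝ (Literature.Analysis.FluidPDE.curl v) x))), ‖Literature.Analysis.FluidPDE.curl v x‖ ^ 2 := by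
  sorry

/-- COMPOSITION (sorry-free): S1 + S2 + S3 ⟹ the crux, by name. -/
theorem ProductionEfficiencyDecay_of :
    Summit.NavierStokesRegularity.NavierStokesRegularity.Theses.EfficiencyFloor.ProductionEfficiencyDecay := by
  unfold Summit.NavierStokesRegularity.NavierStokesRegularity.Theses.EfficiencyFloor.ProductionEfficiencyDecay
  intro ν T hν hT u p hmax hLH hdec ε hε
  obtain ⟨c, hc, hB⟩ := stub_enstrophyBudget
  obtain ⟨Zr, Pr, Sr, hZ⟩ := hB ν T hν hT u p hmax hLH hdec
  obtain ⟨t₁, ht₁, hdep⟩ :=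
    stub_depletionGivenBudget c ν T hc hν hT u p hmax hLH hdec Zr Pr Sr hZ (ε / 2) (half_pos hε)
  have hIoo : ∀ t ∈ Ico t₁ T, t ∈ Ioo 0 T := fun t ht => ⟨ht₁.1.trans_le ht.1, ht.2⟩
  have hpos : ∀ t ∈ Ico t₁ T, 0 < Zr t := fun t ht => (hdep t ht).1
  have hder : ∀ t ∈ Ico t₁ T, ∃ D : ℝ, HasDerivAt Zr D t ∧ D ≤ ε / 2 * Zr t ^ 3 := fun t ht =>
    ⟨2 * Sr t - 2 * ν * Pr t, (hZ t (hIoo t ht)).2.2.2.2.2.1, (hdep t ht).2⟩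
  refine ⟨t₁, ⟨ht₁.1.le, ht₁.2⟩, fun t ht => ?_, fun s t hs hst htT => ?_⟩
  · rw [(hZ t (hIoo t ht)).1]
    exact ⟨ENNReal.ofReal_pos.2 (hpos t ht), ENNReal.ofReal_lt_top⟩
  · have hsI : s ∈ Ico t₁ T := ⟨hs, hst.trans_lt htT⟩
    have htI : t ∈ Ico t₁ T := ⟨hs.trans hst, htT⟩
    rw [(hZ s (hIoo s hsI)).1, (hZ t (hIoo t htI)).1, ENNReal.toReal_ofReal (hpos s hsI).le,
      ENNReal.toReal_ofReal (hpos t htI).le]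
    have h := stub_integrateEfficiency Zr t₁ T (ε / 2) hpos hder s t hs hst htT
    linarith

end Summit.NavierStokesRegularity.NavierStokesRegularity.Cruxes.ProductionEfficiencyDecay

end
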